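import Summits.Ventures.HSemireg.UntwistCocycleTwistJetCompare
import Summits.Ventures.HSemireg.CocycleExtensionComplex
import Summits.Ventures.HSemireg.ComplexAtiyahClass
import Summits.Ventures.HSemireg.UntwistCocycleTwistSigma
import HarnessLib

/-!
# Venture HSemireg — route R1.0, complex carriers: the data of the Leibniz step for `E• ⊗ M`
# (gs-g4 gen 21, brick C5b of `general-structure/COMPLEX-LEIBNIZ-PLAN-gs-g4.md`)

HONEST FRAMING. Homological algebra on the tree's REAL carriers: th-4's termwise cocycle twist
`cocycleTwistComplex c K = K ⊗ M` of a cochain complex `K` of `𝒪_X`-modules (`X` an `S`-scheme), the complexes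
`K ⊗ Ωʲ = twistHodgeComplex X j K` and the termwise `Ωʲ`-twisted Atiyah sequences `twistJetComplexShortComplex X j K`
(whose connecting morphism is `complexAtiyahStep X j K`). This file assembles the INPUT of the extension-comparison
lemma (`CocycleExtensionCompareDerived.triangleOfSESδ_eq_add`) for the pair
`S₁ = ` (the Atiyah sequence of `K`, twisted by `M`, with its outer terms moved by `λ•`), `S₂ = ` (the Atiyah sequence of
`K ⊗ M`). Nothing about any variety; nothing here says HC, HC_CM or HC_AV is proved.

## Contents (everything proved)

* `over_map_sheafHomPrecomp_postcompOver` — exchange law (pre- and post-composition commute, locally);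
  `dlogWedgeCocycleC c j L` — the `dlog`-wedge cocycle as a local `1`-cocycle of COMPLEXES `L ⊗ Ωʲ → L ⊗ Ωʲ⁺¹`.
* `lamC c j K : (K ⊗ Ωʲ) ⊗ M ⟶ (K ⊗ M) ⊗ Ωʲ` — termwise `λ_j = dualHomTwist` (a chain map by
  `twistMap_twistMap_comp_dualHomTwist`), an isomorphism (`isIso_lamC`).
* `leibnizι`, `leibnizπ`, `leibnizS₁` — the short exact sequence
  `0 → (K ⊗ M) ⊗ Ωʲ⁺¹ → Pʲ(K) ⊗ M → (K ⊗ M) ⊗ Ωʲ → 0` (`leibnizS₁_shortExact`), isomorphic to the `M`-twist of the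
  Atiyah sequence of `K` (`leibnizS₁Iso`).
* The four hypotheses of the comparison lemma for `φ^i_x = jetCompare c (K^i) j x`:
  `leibniz_hφ` (overlap differences = the cocycle), `leibniz_hφd` (chain maps), `leibniz_hφι`, `leibniz_hφπ`.

## References

* [Ati57] M. F. Atiyah, *Complex analytic connections in fibre bundles*, Trans. AMS 85 (1957), §4, Prop. 10–12.
* [BF03] R.-O. Buchweitz, H. Flenner, *A semiregularity map for modules and applications to deformations*,
  Compositio Math. 137 (2003), §3 (Atiyah class of complexes).
-/

noncomputable section

set_option backward.isDefEq.respectTransparency false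

open CategoryTheory CategoryTheory.Limits AlgebraicGeometry Opposite TopologicalSpace

namespace Summit.Ventures.HSemireg

namespace CocycleTwist

open Literature.AlgebraicGeometry.Modules Literature.AlgebraicGeometry.Motives
  Literature.AlgebraicGeometry.HodgeTheory Summit.HodgeConjecture.HodgeConjecture.Theorems.PadicPridhamSemiregularity

universe u

variable {S : Type u} [CommRing S] {X : Over (Spec (CommRingCat.of S))} (c : UnitCocycle X.left) (j : ℕ)

/-! ### Exchange law and the `dlog`-wedge cocycle of complexes -/

/-- **Exchange law**: pre-composition (`sheafHomPrecomp h`) and local post-composition (`postcompOver t`) commute.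
[folklore] -/
theorem over_map_sheafHomPrecomp_postcompOver {A A' G G' : X.left.Modules} {V : X.left.Opens} (h : A ⟶ A')
    (t : G.over V ⟶ G'.over V) :
    (SheafOfModules.overFunctor _ V).map (sheafHomPrecomp h G) ≫ postcompOver A t =
      postcompOver A' t ≫ (SheafOfModules.overFunctor _ V).map (sheafHomPrecomp h G') :=
  hom_ext_of_appLE fun W k (ψ : A'.over W ⟶ G.over W) => by
    rw [appLE_comp, appLE_comp, appLE_over_map, appLE_over_map,
      Summit.HodgeConjecture.HodgeConjecture.Theorems.PadicPridhamSemiregularity.sheafHomPrecomp_app_apply,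
      appLE_postcompOver, appLE_postcompOver,
      Summit.HodgeConjecture.HodgeConjecture.Theorems.PadicPridhamSemiregularity.sheafHomPrecomp_app_apply,
      Category.assoc]

/-- **The `dlog`-wedge cocycle of a complex** `L`: degreewise `dlogWedgeCocycle c j (Lⁱ)`; it commutes with the
differentials `d ⊗ 1` by the exchange law. [cite: Atiyah1957, Prop. 12] -/
def dlogWedgeCocycleC (L : CochainComplex X.left.Modules ℤ) :
    LocalOneCocycleC c (twistHodgeComplex X j L) (twistHodgeComplex X (j + 1) L) where
  w i := dlogWedgeCocycle c j (L.X i)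
  comm i i' x y V hx hy := by
    rw [dlogWedgeCocycle_w, dlogWedgeCocycle_w, Functor.mapHomologicalComplex_obj_d, Functor.mapHomologicalComplex_obj_d]
    exact over_map_sheafHomPrecomp_postcompOver (sheafHomPrecomp (L.d i i') (unitModule X.left))
      (wedgeHomAt j (-(dlogForm c x y V hx hy)))

/-- Components of the `dlog`-wedge cocycle of a complex. [folklore] -/
@[simp]
theorem dlogWedgeCocycleC_w (L : CochainComplex X.left.Modules ℤ) (i : ℤ) :
    (dlogWedgeCocycleC c j L).w i = dlogWedgeCocycle c j (L.X i) := rfl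

/-! ### `λ•_j : (K ⊗ Ωʲ) ⊗ M ≅ (K ⊗ M) ⊗ Ωʲ` -/

variable (K : CochainComplex X.left.Modules ℤ)

/-- **`λ•_j`**: termwise `λ_j = dualHomTwist c Kⁱ Ωʲ`, a chain map by naturality of `λ` in the module
(`twistMap_twistMap_comp_dualHomTwist`). [cite: Hartshorne1977, II Ex. 5.1 (b)] -/
def lamC : cocycleTwistComplex c (twistHodgeComplex X j K) ⟶ twistHodgeComplex X j (cocycleTwistComplex c K) where
  f i := dualHomTwist c (K.X i) (hodgeSheaf X j)
  comm' i i' _ := by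
    change dualHomTwist c (K.X i) (hodgeSheaf X j) ≫
        Summit.HodgeConjecture.HodgeConjecture.Theorems.PadicPridhamSemiregularity.twistMap (twistMap c (K.d i i'))
          (hodgeSheaf X j) =
      twistMap c (Summit.HodgeConjecture.HodgeConjecture.Theorems.PadicPridhamSemiregularity.twistMap (K.d i i')
        (hodgeSheaf X j)) ≫ dualHomTwist c (K.X i') (hodgeSheaf X j)
    exact (twistMap_twistMap_comp_dualHomTwist c (hodgeSheaf X j) (K.d i i')).symm

/-- Components of `λ•_j`. [folklore] -/
@[simp]
theorem lamC_f (i : ℤ) : (lamC c j K).f i = dualHomTwist c (K.X i) (hodgeSheaf X j) := rfl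

/-- **`λ•_j` is an isomorphism** (termwise `isIso_dualHomTwist`). [cite: Hartshorne1977, II Ex. 5.1 (b)] -/
instance isIso_lamC : IsIso (lamC c j K) := by
  haveI : ∀ i : ℤ, IsIso ((lamC c j K).f i) := fun i => isIso_dualHomTwist c (K.X i) (hodgeSheaf X j)
  exact HomologicalComplex.Hom.isIso_of_components _

/-! ### The twisted Atiyah sequence of `K`, with outer terms moved by `λ•` -/

/-- `ι₁ = λ•_{j+1}⁻¹ ≫ (ι_j ⊗ M) : (K ⊗ M) ⊗ Ωʲ⁺¹ → Pʲ(K) ⊗ M`. [folklore] -/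
def leibnizι : twistHodgeComplex X (j + 1) (cocycleTwistComplex c K) ⟶ cocycleTwistComplex c (twistJetComplex X j K) :=
  inv (lamC c (j + 1) K) ≫ ((twistEquivalence X.left c).functor.mapHomologicalComplex _).map
    (twistJetComplexShortComplex X j K).f

/-- `π₁ = (π_j ⊗ M) ≫ λ•_j : Pʲ(K) ⊗ M → (K ⊗ M) ⊗ Ωʲ`. [folklore] -/
def leibnizπ : cocycleTwistComplex c (twistJetComplex X j K) ⟶ twistHodgeComplex X j (cocycleTwistComplex c K) :=
  ((twistEquivalence X.left c).functor.mapHomologicalComplex _).map (twistJetComplexShortComplex X j K).g ≫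
    lamC c j K

/-- `ι₁ ≫ π₁ = 0`. [folklore] -/
theorem leibnizι_π : leibnizι c j K ≫ leibnizπ c j K = 0 := by
  rw [leibnizι, leibnizπ, Category.assoc, ← Functor.map_comp_assoc, (twistJetComplexShortComplex X j K).zero,
    Functor.map_zero, Limits.zero_comp, Limits.comp_zero]

/-- **`S₁ : 0 → (K ⊗ M) ⊗ Ωʲ⁺¹ → Pʲ(K) ⊗ M → (K ⊗ M) ⊗ Ωʲ → 0`.** [folklore] -/
abbrev leibnizS₁ : ShortComplex (CochainComplex X.left.Modules ℤ) :=
  ShortComplex.mk (leibnizι c j K) (leibnizπ c j K) (leibnizι_π c j K)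

/-- The components of `ι•_j`, `π•_j` of the termwise Atiyah sequence. [folklore] -/
theorem twistJetComplexShortComplex_f_f (L : CochainComplex X.left.Modules ℤ) (i : ℤ) :
    (twistJetComplexShortComplex X j L).f.f i = twistJetι (L.X i) j := rfl

/-- The components of `π•_j`. [folklore] -/
theorem twistJetComplexShortComplex_g_f (L : CochainComplex X.left.Modules ℤ) (i : ℤ) :
    (twistJetComplexShortComplex X j L).g.f i = twistJetπ (L.X i) j := rfl

/-- Components of `π₁`. [folklore] -/
theorem leibnizπ_f (i : ℤ) :
    (leibnizπ c j K).f i = twistMap c (twistJetπ (K.X i) j) ≫ dualHomTwist c (K.X i) (hodgeSheaf X j) := rfl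

/-- Components of `ι₁`. [folklore] -/
theorem leibnizι_f (i : ℤ) :
    (leibnizι c j K).f i = (inv (lamC c (j + 1) K)).f i ≫ twistMap c (twistJetι (K.X i) j) := rfl

/-- `(λ•⁻¹)ⁱ ≫ λⁱ = 𝟙`. [folklore] -/
theorem inv_lamC_f_comp (i : ℤ) :
    (inv (lamC c (j + 1) K)).f i ≫ dualHomTwist c (K.X i) (hodgeSheaf X (j + 1)) = 𝟙 _ := by
  rw [← lamC_f, ← HomologicalComplex.comp_f, IsIso.inv_hom_id, HomologicalComplex.id_f]

/-- `λⁱ ≫ (λ•⁻¹)ⁱ = 𝟙`. [folklore] -/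
theorem lamC_f_comp_inv (i : ℤ) :
    dualHomTwist c (K.X i) (hodgeSheaf X (j + 1)) ≫ (inv (lamC c (j + 1) K)).f i = 𝟙 _ := by
  rw [← lamC_f, ← HomologicalComplex.comp_f, IsIso.hom_inv_id, HomologicalComplex.id_f]
  rfl

/-- **The morphism of short complexes `(λ•_{j+1}, 𝟙, λ•_j)`** from the `M`-twist of the Atiyah sequence of `K` to `S₁`
(the comparison used with `triangleOfSESδ_naturality`). [folklore] -/
def leibnizS₁Hom :
    (twistJetComplexShortComplex X j K).map ((twistEquivalence X.left c).functor.mapHomologicalComplex _) ⟶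
      leibnizS₁ c j K where
  τ₁ := lamC c (j + 1) K
  τ₂ := 𝟙 _
  τ₃ := lamC c j K
  comm₁₂ := by
    change lamC c (j + 1) K ≫ leibnizι c j K = _ ≫ 𝟙 _
    rw [leibnizι, IsIso.hom_inv_id_assoc, Category.comp_id]
    rfl
  comm₂₃ := by
    change 𝟙 _ ≫ leibnizπ c j K = _ ≫ lamC c j K
    rw [Category.id_comp]
    rfl

/-- In each degree `S₁` is isomorphic to the `M`-twist of the Atiyah sequence of `Kⁱ`. [folklore] -/
def leibnizS₁DegreeIso (i : ℤ) :
    (twistJetShortComplex (K.X i) j).map (twistEquivalence X.left c).functor ≅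
      (leibnizS₁ c j K).map (HomologicalComplex.eval _ _ i) :=
  haveI := isIso_dualHomTwist c (K.X i) (hodgeSheaf X (j + 1))
  haveI := isIso_dualHomTwist c (K.X i) (hodgeSheaf X j)
  ShortComplex.isoMk (asIso (dualHomTwist c (K.X i) (hodgeSheaf X (j + 1)))) (Iso.refl _)
    (asIso (dualHomTwist c (K.X i) (hodgeSheaf X j)))
    (by
      change dualHomTwist c (K.X i) (hodgeSheaf X (j + 1)) ≫ (leibnizι c j K).f i = twistMap c (twistJetι (K.X i) j) ≫ 𝟙 _
      rw [leibnizι_f, ← Category.assoc, lamC_f_comp_inv, Category.id_comp, Category.comp_id])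
    (by
      change 𝟙 _ ≫ (leibnizπ c j K).f i = twistMap c (twistJetπ (K.X i) j) ≫ dualHomTwist c (K.X i) (hodgeSheaf X j)
      rw [Category.id_comp, leibnizπ_f])

/-- **`S₁` is short exact** (degreewise the `M`-twist of a short exact sequence, `- ⊗ M` an equivalence).
[folklore] -/
theorem leibnizS₁_shortExact : (leibnizS₁ c j K).ShortExact :=
  HomologicalComplex.shortExact_of_degreewise_shortExact _ fun i =>
    ShortComplex.shortExact_of_iso (leibnizS₁DegreeIso c j K i)
      ((twistJetShortComplex_shortExact (K.X i) j).map_of_exact (twistEquivalence X.left c).functor)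

/-! ### The hypotheses of the extension-comparison lemma for `φ^i_x = jetCompare c Kⁱ j x` -/

/-- The differential of `K ⊗ M` is `d ⊗ M` termwise. [folklore] -/
theorem cocycleTwistComplex_d (L : CochainComplex X.left.Modules ℤ) (i i' : ℤ) :
    (cocycleTwistComplex c L).d i i' = twistMap c (L.d i i') := rfl

/-- The differential of `Pʲ(L)` is `Pʲ(d)` termwise. [folklore] -/
theorem twistJetComplex_d (L : CochainComplex X.left.Modules ℤ) (i i' : ℤ) :
    (twistJetComplex X j L).d i i' = twistJetMap (L.d i i') j := rfl

/-- **(hφ)** the overlap differences of `α^i_x` are `π₁ⁱ| ≫ w_{xy} ≫ ι₂ⁱ|` (`jetCompare_sub`). [cite: Atiyah1957, §4] -/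
theorem leibniz_hφ (i : ℤ) (x y : X.left) (V : X.left.Opens) (hx : V ≤ c.U x) (hy : V ≤ c.U y) :
    restrictHom (homOfLE hy) (jetCompare c (K.X i) j y) - restrictHom (homOfLE hx) (jetCompare c (K.X i) j x) =
      (SheafOfModules.overFunctor _ V).map ((leibnizπ c j K).f i) ≫
        ((dlogWedgeCocycleC c j (cocycleTwistComplex c K)).w i).w x y V hx hy ≫
          (SheafOfModules.overFunctor _ V).map ((twistJetComplexShortComplex X j (cocycleTwistComplex c K)).f.f i) := by
  rw [leibnizπ_f, dlogWedgeCocycleC_w, twistJetComplexShortComplex_f_f]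
  exact jetCompare_sub c (K.X i) j x y V hx hy

/-- **(hφd)** the `α^i_x` commute with the differentials (`jetCompare_naturality`). [folklore] -/
theorem leibniz_hφd (i i' : ℤ) (x : X.left) :
    jetCompare c (K.X i) j x ≫ (SheafOfModules.overFunctor _ (c.U x)).map
        ((twistJetComplex X j (cocycleTwistComplex c K)).d i i') =
      (SheafOfModules.overFunctor _ (c.U x)).map ((cocycleTwistComplex c (twistJetComplex X j K)).d i i') ≫
        jetCompare c (K.X i') j x := by
  rw [twistJetComplex_d, cocycleTwistComplex_d, cocycleTwistComplex_d]
  exact (jetCompare_naturality c j (K.d i i') x).symm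

/-- **(hφι)** `ι₁ⁱ| ≫ α^i_x = ι₂ⁱ|` (`ι_jetCompare`). [folklore] -/
theorem leibniz_hφι (i : ℤ) (x : X.left) :
    (SheafOfModules.overFunctor _ (c.U x)).map ((leibnizι c j K).f i) ≫ jetCompare c (K.X i) j x =
      (SheafOfModules.overFunctor _ (c.U x)).map ((twistJetComplexShortComplex X j (cocycleTwistComplex c K)).f.f i) := by
  rw [leibnizι_f, Functor.map_comp, Category.assoc, ι_jetCompare, ← Functor.map_comp_assoc, inv_lamC_f_comp,
    CategoryTheory.Functor.map_id, Category.id_comp, twistJetComplexShortComplex_f_f]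
  rfl

/-- **(hφπ)** `α^i_x ≫ π₂ⁱ| = π₁ⁱ|` (`jetCompare_π`). [folklore] -/
theorem leibniz_hφπ (i : ℤ) (x : X.left) :
    jetCompare c (K.X i) j x ≫ (SheafOfModules.overFunctor _ (c.U x)).map
        ((twistJetComplexShortComplex X j (cocycleTwistComplex c K)).g.f i) =
      (SheafOfModules.overFunctor _ (c.U x)).map ((leibnizπ c j K).f i) := by
  rw [leibnizπ_f, Functor.map_comp, twistJetComplexShortComplex_g_f]
  exact jetCompare_π c (K.X i) j x

end CocycleTwist

end Summit.Ventures.HSemireg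

end
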